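import Mathlib
import HarnessLib
import Summits.Ventures.LatticeQCDFlow.Exactness.OpenBoundaryWilsonAction
import Summits.Ventures.LatticeQCDFlow.Scoring.CloverChargeLawSymmetric
import Summits.Ventures.LatticeQCDFlow.Scoring.CloverChargeMeanZero

/-!
# The open-boundary Gibbs law is invariant under the time reflection exchanging the two boundaries; `⟨Q⟩ = 0` and the law of the clover charge is symmetric with open boundary conditions

HONEST FRAMING: exact (Metropolis-corrected) sampling algorithms for lattice gauge theory;
figures of merit are autocorrelation/cost numbers at stated couplings and volumes; no
continuum-physics claim.

Venture `LatticeQCDFlow` (cell pub-lqcd), topic `Exactness`, FANOUT row 21 (`su3-base`, arm `OBC-HMC`: HMC with OPEN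
boundary conditions in time, realised by the engine on the periodic lattice through the plaquette weights
`obcWeight τ` of `OpenBoundaryWilsonAction.lean` — weight `0` on the temporal plaquettes through a wrap-around
("dead") link, `½` on the spatial plaquettes of the two boundary slices `x_τ ∈ {0, −1}`, `1` elsewhere).  NEW WORK of
the cell over the tree (`OpenBoundaryWilsonAction.lean`: `obcWeight`, `obcAction`, the open-boundary Gibbs law
`gibbsProbability (Haar^⊗) (e^{−β S_OBC})`; `PTBCWilsonDefect.lean`: `weightedWilsonAction`, the lattice translation
`configTranslate v` and `plaquetteHolonomy_configTranslate`; the Literature site time reflection `Θ' = GaugeConfig.negReflect`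
(`θ'(t, x⃗) = (−t, x⃗)`, temporal links reversed) with `WilsonSiteRP.plaqRe_negReflect`, `sitePlaqReflect`,
`negReflectEquiv`, `measurePreserving_negReflect`; row 16's `Scoring/CloverChargeMeanZero` + `CloverChargeLawSymmetric`:
odd observables of a measure-preserving equivalence have zero mean and a symmetric law, `cloverPseudoscalar_negReflect`).
Nothing is cited as a fact; no number.  Printed counterpart, NAMED ONLY: Lüscher–Schaefer, JHEP 07 (2011) 036, §2.1
(with open boundary conditions the theory keeps the time reflection exchanging the two boundaries; `⟨Q⟩ = 0`).

## The point

The periodic Wilson measure is invariant under `Θ'` (reflection in the slice `t = 0`), which is how row 16 proved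
`⟨Q⟩ = 0`.  The open-boundary weights are NOT `Θ'`-invariant (`Θ'` maps the boundary pair `{0, −1}` to `{0, 1}`); the
symmetry of the open lattice is the reflection `t ↦ −1 − t` in the hyperplane `t = −½` through the cut, EXCHANGING THE
TWO BOUNDARY SLICES, i.e. `Θ'` followed by the unit time translation: `R U = configTranslate e₀ (Θ' U)` (a link
reflection; the Literature's `GaugeConfig.timeReflect`, `θ(t) = 1 − t`, is its translate by two units and is not used
here — `R` is assembled from `Θ'` so that row 16's clover parity lemma `cloverPseudoscalar_negReflect` applies verbatim).
This file proves that `R` preserves the open-boundary Gibbs law and draws the run checks of the `OBC-HMC` arm from it;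
no definition is introduced (`R` is the measurable equivalence `negReflectEquiv.trans (configTranslate e₀)` throughout).

## What is proved (time direction `0`, every `d ≥ 1`, `L ≥ 1`, any group `G`, any representation `ρ`, all weights `w`)

* §1 `weightedWilsonAction_configTranslate_eq` — `S_w(T_v U) = S_{w(−v + ·)}(U)`; `weightedWilsonAction_negReflect` —
  `S_w(Θ'U) = S_{w ∘ ϑ'}(U)` (`ϑ' = sitePlaqReflect`; compact `G`, continuous `ρ`): ANY plaquette-weighted Wilson action
  transforms by moving the weights.
* §2 **`obcWeight_zero_obcReflect`** — the open-boundary weights are invariant under the plaquette map of `R`;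
  **`obcAction_obcReflect`** — `S_OBC(R U) = S_OBC(U)`.
* §3 **`obcGibbs_map_obcReflect`** / `measurePreserving_obcReflect_obcGibbs` — compact `G`, continuous `ρ`, every real
  `β`: `R = negReflectEquiv.trans (configTranslate e₀)` preserves `Z⁻¹ e^{−β S_OBC} · Haar^{⊗ edges}` (product Haar is
  invariant under both factors; the density by §2).
* §4 `R`-ODD OBSERVABLES (`F (R U) = −F U`): **`obcGibbs_integral_eq_zero_of_odd`** (`∫ F = 0`, vector-valued, no
  integrability needed), `obcGibbs_measure_setOf_odd_symm` (`P{F ∈ A} = P{−F ∈ A}` for EVERY set `A`),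
  `obcGibbs_tail_symm_of_odd`, `obcGibbs_map_neg_of_odd` (the law of `F` is symmetric), `obcGibbs_integral_pow_odd_of_odd`.
* §5 THE CLOVER CHARGE (`d = 4`, unitary `ρ`): `cloverLeafSum_translate`, `cloverPseudoscalar_configTranslate`
  (`P_x(T_v U) = P_{v + x}(U)`), **`cloverPseudoscalar_obcReflect`** (`P_x(R U) = −P_{r x}(U)`, `r x = θ'x − e₀`, an
  involution: `obcReflectSite_involutive`), **`sum_cloverPseudoscalar_obcReflect`** — for every finite set `S` of
  sites closed under `r` (all sites; the sites off the two boundary slices; any union of mirror slice pairs) the charge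
  `Q_S = Σ_{x ∈ S} P_x` is `R`-odd; hence under the open-boundary Gibbs law, for every real `β` and every `L ≥ 1`:
  **`obcGibbs_cloverCharge_integral_eq_zero`** (`⟨Q_S⟩_OBC = 0`), **`obcGibbs_cloverCharge_tail_symm`**
  (`P(c ≤ Q_S) = P(Q_S ≤ −c)`), **`obcGibbs_map_cloverCharge_neg_invariant`** (the law of `Q_S` is symmetric about `0`),
  **`obcGibbs_cloverCharge_pow_odd_eq_zero`** (`⟨Q_S^{2k+1}⟩ = 0`); `obcGibbs_su_cloverCharge_integral_eq_zero` — the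
  `SU(N)` fundamental instance over all sites (row 21: `N = 3`).

Run checks of the `OBC-HMC` arm (as row 16's periodic ones): a measured `⟨Q⟩ ≠ 0` or an asymmetric `Q`-histogram
beyond errors indicts the sampler or the estimator, never the target.  NOT CLAIMED: anything about the charge AFTER the engine's flow / cooling with open boundaries (the weighted smoothing
maps are not typed; the periodic `wilsonFlow` of the tree is the wrong flow there); `⟨Q²⟩`, its non-integrality or
`τ_int` with open boundaries (MEASURED by the arm); spatial translations; the boundary improvement coefficient; numbers.
-/

noncomputable section

namespace Summit.Ventures.LatticeQCDFlow.Exactness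

open MeasureTheory Set Function
open Literature.MathematicalPhysics.QuantumFieldTheory
open Literature.MathematicalPhysics.QuantumFieldTheory.WilsonSiteRP (sitePlaqReflect sitePlaqReflectEquiv
  negReflectEquiv)
open Literature.MathematicalPhysics.QuantumLattice (cloverPseudoscalar cloverLeafSum continuous_cloverPseudoscalar
  measurable_cloverPseudoscalar fundamentalRep continuous_fundamentalRep fundamentalRep_mem_unitaryGroup)
open scoped ENNReal

/-! ## §1 Weighted Wilson actions under translations and the site time reflection -/

section Weighted

variable {d L N : ℕ} [NeZero L] {G : Type*} [Group G] (w : Plaquette d L → ℝ) (ρ : G →* Matrix (Fin N) (Fin N) ℂ)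

/-- The weighted action through the plaquette traces `Re tr ρ(U_p)`. -/
theorem weightedWilsonAction_eq_sum_plaqRe (U : GaugeConfig d L G) :
    weightedWilsonAction w ρ U = ∑ p : Plaquette d L, w p * ((N : ℝ) - WilsonRP.plaqRe ρ U p) := rfl

/-- **Translating the configuration moves the weights**: `S_w(T_v U) = S_{w(−v + ·)}(U)` (reindex by `p ↦ v + p`). -/
theorem weightedWilsonAction_configTranslate_eq [MeasurableSpace G] (v : Site d L) (U : GaugeConfig d L G) :
    weightedWilsonAction w ρ (configTranslate v U) =
      weightedWilsonAction (fun q : Plaquette d L => w (-v + q.1, q.2)) ρ U := by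
  unfold weightedWilsonAction
  simp_rw [plaquetteHolonomy_configTranslate]
  refine Fintype.sum_equiv ((Equiv.addLeft v).prodCongr (Equiv.refl _)) _ _ fun p => ?_
  simp only [Equiv.prodCongr_apply, Prod.map_fst, Prod.map_snd, Equiv.coe_addLeft, Equiv.refl_apply,
    neg_add_cancel_left, Prod.mk.eta]

variable [NeZero d] [TopologicalSpace G] [IsTopologicalGroup G] [CompactSpace G]

/-- **Reflecting the configuration moves the weights**: `S_w(Θ'U) = S_{w ∘ ϑ'}(U)`, `ϑ' = sitePlaqReflect` (the reflected
holonomy is that of the reflected plaquette up to inversion/conjugation, invisible to `Re tr ρ` on a compact group). -/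
theorem weightedWilsonAction_negReflect (hρ : Continuous ρ) (U : GaugeConfig d L G) :
    weightedWilsonAction w ρ U.negReflect = weightedWilsonAction (w ∘ sitePlaqReflect) ρ U := by
  rw [weightedWilsonAction_eq_sum_plaqRe, weightedWilsonAction_eq_sum_plaqRe]
  simp_rw [WilsonSiteRP.plaqRe_negReflect ρ hρ U]
  refine Fintype.sum_equiv (sitePlaqReflectEquiv (d := d) (L := L)) _ _ fun p => ?_
  have hp : sitePlaqReflectEquiv (d := d) (L := L) p = sitePlaqReflect p := rfl
  rw [hp, Function.comp_apply, WilsonSiteRP.sitePlaqReflect_sitePlaqReflect]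

end Weighted

/-! ## §2 The open-boundary weights and action are invariant under `R = T_{e₀} ∘ Θ'` -/

section OBC

variable {d L : ℕ} [NeZero d]

/-- The time coordinate of `−e₀ + θ'(x + e₀)` is `−x₀ − 2`. -/
theorem neg_single_add_negReflect_shift_apply_zero (x : Site d L) :
    (-(Pi.single 0 1 : Site d L) + (x.shift 0).negReflect) 0 = -x 0 - 2 := by
  rw [Pi.add_apply, Pi.neg_apply, Pi.single_eq_same, WilsonSiteRP.negReflect_apply_zero, Site.shift, Pi.add_apply,
    Pi.single_eq_same]
  ring

/-- The time coordinate of `−e₀ + θ'x` is `−x₀ − 1`. -/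
theorem neg_single_add_negReflect_apply_zero (x : Site d L) :
    (-(Pi.single 0 1 : Site d L) + x.negReflect) 0 = -x 0 - 1 := by
  rw [Pi.add_apply, Pi.neg_apply, Pi.single_eq_same, WilsonSiteRP.negReflect_apply_zero]
  ring

/-- **The open-boundary weights are invariant under the plaquette map of `R`**, `q ↦ −e₀ + ϑ'q` (temporal plaquettes
based at `t` go to `−t − 2`, so `t = −1 ↔ −t − 2 = −1`; spatial ones in slice `t` go to slice `−t − 1`: `0 ↔ −1`). -/
theorem obcWeight_zero_obcReflect (q : Plaquette d L) :
    obcWeight (0 : Fin d) (-(Pi.single 0 1 : Site d L) + (sitePlaqReflect q).1, (sitePlaqReflect q).2) =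
      obcWeight 0 q := by
  obtain ⟨x, ⟨⟨i, j⟩, hij⟩⟩ := q
  have hj : j ≠ 0 := fun h => by
    subst h
    exact (Nat.not_lt_zero _ hij)
  unfold obcWeight
  simp only [sitePlaqReflect]
  by_cases hi : i = 0
  · subst hi
    simp only [true_or, if_true, neg_single_add_negReflect_shift_apply_zero]
    have hiff : (-x 0 - 2 = (-1 : ZMod L)) ↔ x 0 = -1 := by constructor <;> intro h <;> linear_combination -h
    simp only [hiff]
  · simp only [hi, hj, or_self, if_false, neg_single_add_negReflect_apply_zero]
    have h1 : (-x 0 - 1 = (-1 : ZMod L)) ↔ x 0 = 0 := by constructor <;> intro h <;> linear_combination -h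
    have h2 : (-x 0 - 1 = (0 : ZMod L)) ↔ x 0 = -1 := by constructor <;> intro h <;> linear_combination -h
    simp only [h1, h2, or_comm]

variable {N : ℕ} [NeZero L] {G : Type*} [Group G] [TopologicalSpace G] [IsTopologicalGroup G] [CompactSpace G]
  [MeasurableSpace G] (ρ : G →* Matrix (Fin N) (Fin N) ℂ)

/-- **`S_OBC(R U) = S_OBC(U)`**: the open-boundary action (time direction `0`) is invariant under the reflection
`R U = T_{e₀}(Θ'U)` exchanging the two boundary slices (compact `G`, continuous `ρ`, every `d, L ≥ 1`). -/
theorem obcAction_obcReflect (hρ : Continuous ρ) (U : GaugeConfig d L G) :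
    obcAction ρ 0 (configTranslate (Pi.single 0 1) U.negReflect) = obcAction ρ 0 U := by
  unfold obcAction
  rw [weightedWilsonAction_configTranslate_eq, weightedWilsonAction_negReflect _ ρ hρ]
  congr 1
  funext q
  rw [Function.comp_apply]
  exact obcWeight_zero_obcReflect q

end OBC

/-! ## §3 `R` preserves the open-boundary Gibbs law -/

section Gibbs

variable {d L N : ℕ} [NeZero d] [NeZero L] {G : Type*} [Group G] [TopologicalSpace G] [IsTopologicalGroup G]
  [CompactSpace G] [MeasurableSpace G] [BorelSpace G] (ρ : G →* Matrix (Fin N) (Fin N) ℂ)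

omit [NeZero L] [CompactSpace G] in
/-- `R = negReflectEquiv.trans (configTranslate e₀)` acts as `U ↦ T_{e₀}(Θ'U)`. -/
theorem obcReflect_apply (U : GaugeConfig d L G) :
    (negReflectEquiv.trans (configTranslate (G := G) (Pi.single (0 : Fin d) (1 : ZMod L)))) U =
      configTranslate (Pi.single 0 1) U.negReflect := rfl

/-- `R` preserves the product Haar measure of the links. -/
theorem measurePreserving_obcReflect_piHaar :
    MeasurePreserving (negReflectEquiv.trans (configTranslate (G := G) (Pi.single (0 : Fin d) (1 : ZMod L))))
      (Measure.pi fun _ : Edge d L => haarProbability G) (Measure.pi fun _ : Edge d L => haarProbability G) :=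
  (measurePreserving_configTranslate (Pi.single (0 : Fin d) (1 : ZMod L)) (haarProbability G)).comp
    WilsonSiteRP.measurePreserving_negReflect

/-- **THE OPEN-BOUNDARY GIBBS LAW IS `R`-INVARIANT**: `(Z⁻¹ e^{−β S_OBC} · Haar^⊗) ∘ R⁻¹ = Z⁻¹ e^{−β S_OBC} · Haar^⊗` for
every real `β` (continuous `ρ`, compact `G`, every `d, L ≥ 1`). -/
theorem obcGibbs_map_obcReflect (hρ : Continuous ρ) (β : ℝ) :
    (gibbsProbability (Measure.pi fun _ : Edge d L => haarProbability G) (fun U => Real.exp (-(β * obcAction ρ 0 U)))).map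
        (negReflectEquiv.trans (configTranslate (G := G) (Pi.single (0 : Fin d) (1 : ZMod L)))) =
      gibbsProbability (Measure.pi fun _ : Edge d L => haarProbability G) (fun U => Real.exp (-(β * obcAction ρ 0 U))) := by
  unfold gibbsProbability
  rw [Measure.map_smul]
  congr 1
  exact WilsonGauge.withDensity_map_equiv_of_invariant _ _ _ (measurePreserving_obcReflect_piHaar (G := G)).map_eq
    fun U => by simp only [obcReflect_apply, obcAction_obcReflect ρ hρ]

/-- `R` is a measure-preserving equivalence of the open-boundary Gibbs law. -/
theorem measurePreserving_obcReflect_obcGibbs (hρ : Continuous ρ) (β : ℝ) :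
    MeasurePreserving (negReflectEquiv.trans (configTranslate (G := G) (Pi.single (0 : Fin d) (1 : ZMod L))))
      (gibbsProbability (Measure.pi fun _ : Edge d L => haarProbability G) (fun U => Real.exp (-(β * obcAction ρ 0 U))))
      (gibbsProbability (Measure.pi fun _ : Edge d L => haarProbability G) (fun U => Real.exp (-(β * obcAction ρ 0 U)))) :=
  ⟨MeasurableEquiv.measurable _, obcGibbs_map_obcReflect ρ hρ β⟩

/-! ## §4 `R`-odd observables: zero mean and a symmetric law under the open-boundary Gibbs law -/

/-- **`R`-odd observables have zero open-boundary mean**: `F(T_{e₀}(Θ'U)) = −F(U)` for all `U` gives `∫ F = 0`. -/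
theorem obcGibbs_integral_eq_zero_of_odd (hρ : Continuous ρ) (β : ℝ) {V : Type*} [NormedAddCommGroup V]
    [NormedSpace ℝ V] {F : GaugeConfig d L G → V} (hF : ∀ U, F (configTranslate (Pi.single 0 1) U.negReflect) = -F U) :
    ∫ U, F U ∂(gibbsProbability (Measure.pi fun _ : Edge d L => haarProbability G)
      (fun U => Real.exp (-(β * obcAction ρ 0 U)))) = 0 :=
  Scoring.integral_eq_zero_of_measurePreserving_odd _ (measurePreserving_obcReflect_obcGibbs ρ hρ β) hF

/-- **`P{F ∈ A} = P{−F ∈ A}`** for EVERY set `A` and every `R`-odd real observable `F`. -/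
theorem obcGibbs_measure_setOf_odd_symm (hρ : Continuous ρ) (β : ℝ) {F : GaugeConfig d L G → ℝ}
    (hF : ∀ U, F (configTranslate (Pi.single 0 1) U.negReflect) = -F U) (A : Set ℝ) :
    gibbsProbability (Measure.pi fun _ : Edge d L => haarProbability G) (fun U => Real.exp (-(β * obcAction ρ 0 U)))
        {U | F U ∈ A} =
      gibbsProbability (Measure.pi fun _ : Edge d L => haarProbability G) (fun U => Real.exp (-(β * obcAction ρ 0 U)))
        {U | -F U ∈ A} :=
  Scoring.measure_setOf_odd_symm _ (measurePreserving_obcReflect_obcGibbs ρ hρ β) hF A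

/-- **Tail symmetry** `P{c ≤ F} = P{F ≤ −c}` for every `R`-odd real observable. -/
theorem obcGibbs_tail_symm_of_odd (hρ : Continuous ρ) (β : ℝ) {F : GaugeConfig d L G → ℝ}
    (hF : ∀ U, F (configTranslate (Pi.single 0 1) U.negReflect) = -F U) (c : ℝ) :
    gibbsProbability (Measure.pi fun _ : Edge d L => haarProbability G) (fun U => Real.exp (-(β * obcAction ρ 0 U)))
        {U | c ≤ F U} =
      gibbsProbability (Measure.pi fun _ : Edge d L => haarProbability G) (fun U => Real.exp (-(β * obcAction ρ 0 U)))
        {U | F U ≤ -c} :=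
  Scoring.measure_le_eq_measure_le_neg_of_odd _ (measurePreserving_obcReflect_obcGibbs ρ hρ β) hF c

/-- **The law of an `R`-odd observable is symmetric about `0`** (a.e.-measurable `F`). -/
theorem obcGibbs_map_neg_of_odd (hρ : Continuous ρ) (β : ℝ) {F : GaugeConfig d L G → ℝ}
    (hFm : AEMeasurable F (gibbsProbability (Measure.pi fun _ : Edge d L => haarProbability G)
      (fun U => Real.exp (-(β * obcAction ρ 0 U)))))
    (hF : ∀ U, F (configTranslate (Pi.single 0 1) U.negReflect) = -F U) :
    ((gibbsProbability (Measure.pi fun _ : Edge d L => haarProbability G)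
        (fun U => Real.exp (-(β * obcAction ρ 0 U)))).map F).map Neg.neg =
      (gibbsProbability (Measure.pi fun _ : Edge d L => haarProbability G)
        (fun U => Real.exp (-(β * obcAction ρ 0 U)))).map F :=
  Scoring.map_neg_map_of_odd _ (measurePreserving_obcReflect_obcGibbs ρ hρ β) hFm hF

/-- **Odd moments of an `R`-odd observable vanish**: `∫ F^{2k+1} = 0`. -/
theorem obcGibbs_integral_pow_odd_of_odd (hρ : Continuous ρ) (β : ℝ) {F : GaugeConfig d L G → ℝ}
    (hF : ∀ U, F (configTranslate (Pi.single 0 1) U.negReflect) = -F U) (k : ℕ) :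
    ∫ U, F U ^ (2 * k + 1) ∂(gibbsProbability (Measure.pi fun _ : Edge d L => haarProbability G)
      (fun U => Real.exp (-(β * obcAction ρ 0 U)))) = 0 :=
  Scoring.integral_pow_odd_eq_zero_of_odd _ (measurePreserving_obcReflect_obcGibbs ρ hρ β) hF k

end Gibbs

/-! ## §5 The clover charge is `R`-odd on every `R`-symmetric set of sites; `⟨Q⟩_OBC = 0`, symmetric law -/

section Clover

variable {L N : ℕ} {G : Type*} [Group G] (ρ : G →* Matrix (Fin N) (Fin N) ℂ)

/-- Translating a matrix link field translates the clover sum: `Q_{μν}(x)[V(v + ·)] = Q_{μν}(v + x)[V]`. -/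
theorem cloverLeafSum_translate {d : ℕ} (V : Literature.MathematicalPhysics.QuantumLattice.MatrixLinkField d (ZMod L) N)
    (v x : Fin d → ZMod L) (μ ν : Fin d) :
    cloverLeafSum (fun e => V (v + e.1, e.2)) x μ ν = cloverLeafSum V (v + x) μ ν := by
  simp only [cloverLeafSum, sub_eq_add_neg, add_assoc]

omit [Group G] in
/-- The translated configuration read at a link: `(T_v U)(x, i) = U(v + x, i)`. -/
theorem configTranslate_apply_edge {d : ℕ} [MeasurableSpace G] (v : Site d L) (U : GaugeConfig d L G) (e : Edge d L) :
    configTranslate v U e = U (v + e.1, e.2) := by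
  obtain ⟨x, i⟩ := e
  rw [configTranslate_apply]
  rfl

/-- **`P_x(T_v U) = P_{v + x}(U)`**: the bare clover charge density of the translated configuration. -/
theorem cloverPseudoscalar_configTranslate [MeasurableSpace G] (v x : Site 4 L) (U : GaugeConfig 4 L G) :
    cloverPseudoscalar ρ x (configTranslate v U) = cloverPseudoscalar ρ (v + x) U := by
  have hV : (fun e : Edge 4 L => ρ (configTranslate v U e)) =
      fun e => (fun e' : Edge 4 L => ρ (U e')) (v + e.1, e.2) :=
    funext fun e => by rw [configTranslate_apply_edge]
  have hC : ∀ μ ν, Literature.MathematicalPhysics.QuantumLattice.flowedClover ρ 0 (configTranslate v U) x μ ν =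
      Literature.MathematicalPhysics.QuantumLattice.flowedClover ρ 0 U (v + x) μ ν := fun μ ν => by
    rw [Literature.MathematicalPhysics.QuantumLattice.flowedClover_zero,
      Literature.MathematicalPhysics.QuantumLattice.flowedClover_zero, hV]
    exact congrArg (fun M => Literature.MathematicalPhysics.QuantumLattice.lieProjection (Set.range ρ) ((1 / 4 : ℝ) • M))
      (cloverLeafSum_translate (fun e => ρ (U e)) v x μ ν)
  simp only [cloverPseudoscalar, hC]

/-- The site map of `R` on observables, `r x = θ'x − e₀` (`t ↦ −1 − t`), is an involution: `r (r x) = x`. -/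
theorem obcReflectSite_obcReflectSite (x : Site 4 L) :
    (x.negReflect - Pi.single 0 1).negReflect - Pi.single 0 1 = x := by
  have h := Scoring.negReflect_add_single_zero (d := 4) (L := L) (x.negReflect - Pi.single 0 1)
  rw [sub_add_cancel, WilsonSiteRP.negReflect_negReflect] at h
  exact h.symm

/-- `r` as an involution of the sites. -/
theorem obcReflectSite_involutive : Function.Involutive fun x : Site 4 L => x.negReflect - Pi.single 0 1 :=
  obcReflectSite_obcReflectSite

/-- **`P_x(R U) = −P_{r x}(U)`** with `r x = θ'x − e₀`: the bare clover charge density is odd under the open lattice's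
time reflection (unitary `ρ`). -/
theorem cloverPseudoscalar_obcReflect [MeasurableSpace G] (hρu : ∀ g, ρ g ∈ Matrix.unitaryGroup (Fin N) ℂ)
    (x : Site 4 L) (U : GaugeConfig 4 L G) :
    cloverPseudoscalar ρ x (configTranslate (Pi.single 0 1) U.negReflect) =
      -cloverPseudoscalar ρ (x.negReflect - Pi.single 0 1) U := by
  rw [cloverPseudoscalar_configTranslate, Scoring.cloverPseudoscalar_negReflect ρ hρu, add_comm,
    Scoring.negReflect_add_single_zero]

/-- Reindexing a site sum over an `r`-symmetric set by the involution `r`. -/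
theorem sum_obcReflectSite_eq {S : Finset (Site 4 L)} (hS : ∀ x ∈ S, x.negReflect - Pi.single 0 1 ∈ S)
    (f : Site 4 L → ℝ) : ∑ x ∈ S, f (x.negReflect - Pi.single 0 1) = ∑ x ∈ S, f x := by
  refine Finset.sum_equiv (obcReflectSite_involutive (L := L)).toPerm (fun x => ?_) (fun x _ => ?_)
  · simp only [Function.Involutive.coe_toPerm]
    refine ⟨hS x, fun hx => ?_⟩
    have h := hS _ hx
    rwa [obcReflectSite_obcReflectSite] at h
  · simp only [Function.Involutive.coe_toPerm]

/-- **The clover charge of an `r`-symmetric set of sites is `R`-odd**: for every finite set `S` of sites with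
`r S ⊆ S`, `Σ_{x ∈ S} P_x(R U) = −Σ_{x ∈ S} P_x(U)`. -/
theorem sum_cloverPseudoscalar_obcReflect [MeasurableSpace G] (hρu : ∀ g, ρ g ∈ Matrix.unitaryGroup (Fin N) ℂ)
    {S : Finset (Site 4 L)} (hS : ∀ x ∈ S, x.negReflect - Pi.single 0 1 ∈ S) (U : GaugeConfig 4 L G) :
    ∑ x ∈ S, cloverPseudoscalar ρ x (configTranslate (Pi.single 0 1) U.negReflect) =
      -∑ x ∈ S, cloverPseudoscalar ρ x U := by
  rw [Finset.sum_congr rfl fun x _ => cloverPseudoscalar_obcReflect ρ hρu x U, Finset.sum_neg_distrib,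
    sum_obcReflectSite_eq hS fun x => cloverPseudoscalar ρ x U]

/-- All sites form an `r`-symmetric set. -/
theorem obcReflectSite_mem_univ [NeZero L] (x : Site 4 L) (_hx : x ∈ (Finset.univ : Finset (Site 4 L))) :
    x.negReflect - Pi.single 0 1 ∈ (Finset.univ : Finset (Site 4 L)) := Finset.mem_univ _

/-- The sites off the two boundary slices (`x₀ ∉ {0, −1}`) form an `r`-symmetric set (`r : t ↦ −1 − t`). -/
theorem obcReflectSite_mem_interior [NeZero L] (x : Site 4 L)
    (hx : x ∈ (Finset.univ.filter fun y : Site 4 L => y 0 ≠ 0 ∧ y 0 ≠ -1)) :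
    x.negReflect - Pi.single 0 1 ∈ (Finset.univ.filter fun y : Site 4 L => y 0 ≠ 0 ∧ y 0 ≠ -1) := by
  simp only [Finset.mem_filter, Finset.mem_univ, true_and, Pi.sub_apply, WilsonSiteRP.negReflect_apply_zero,
    Pi.single_eq_same] at hx ⊢
  obtain ⟨h0, h1⟩ := hx
  constructor
  · intro h
    exact h1 (by linear_combination -h)
  · intro h
    exact h0 (by linear_combination -h)

variable [TopologicalSpace G] [IsTopologicalGroup G] [CompactSpace G] [MeasurableSpace G] [BorelSpace G]

/-- **`⟨Q_S⟩_OBC = 0` EXACTLY**: every torus `(ℤ/L)^4` (`L ≥ 1`), compact `G`, continuous unitary `ρ`, every real `β`,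
every `r`-symmetric finite set `S` of sites: the open-boundary Gibbs mean of `Q_S = Σ_{x ∈ S} P_x` vanishes. -/
theorem obcGibbs_cloverCharge_integral_eq_zero [NeZero L] (hρ : Continuous ρ)
    (hρu : ∀ g, ρ g ∈ Matrix.unitaryGroup (Fin N) ℂ) (β : ℝ) {S : Finset (Site 4 L)}
    (hS : ∀ x ∈ S, x.negReflect - Pi.single 0 1 ∈ S) :
    ∫ U, ∑ x ∈ S, cloverPseudoscalar ρ x U ∂(gibbsProbability (Measure.pi fun _ : Edge 4 L => haarProbability G)
      (fun U => Real.exp (-(β * obcAction ρ 0 U)))) = 0 :=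
  obcGibbs_integral_eq_zero_of_odd ρ hρ β (sum_cloverPseudoscalar_obcReflect ρ hρu hS)

/-- **Tail symmetry of the open-boundary charge**: `P(c ≤ Q_S) = P(Q_S ≤ −c)` for every real `c`. -/
theorem obcGibbs_cloverCharge_tail_symm [NeZero L] (hρ : Continuous ρ)
    (hρu : ∀ g, ρ g ∈ Matrix.unitaryGroup (Fin N) ℂ) (β c : ℝ) {S : Finset (Site 4 L)}
    (hS : ∀ x ∈ S, x.negReflect - Pi.single 0 1 ∈ S) :
    gibbsProbability (Measure.pi fun _ : Edge 4 L => haarProbability G) (fun U => Real.exp (-(β * obcAction ρ 0 U)))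
        {U | c ≤ ∑ x ∈ S, cloverPseudoscalar ρ x U} =
      gibbsProbability (Measure.pi fun _ : Edge 4 L => haarProbability G) (fun U => Real.exp (-(β * obcAction ρ 0 U)))
        {U | ∑ x ∈ S, cloverPseudoscalar ρ x U ≤ -c} :=
  obcGibbs_tail_symm_of_odd ρ hρ β (sum_cloverPseudoscalar_obcReflect ρ hρu hS) c

/-- **The law of the open-boundary charge `Q_S` is symmetric about `0`** (second-countable `G`: `Q_S` measurable). -/
theorem obcGibbs_map_cloverCharge_neg_invariant [NeZero L] [SecondCountableTopology G] (hρ : Continuous ρ)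
    (hρu : ∀ g, ρ g ∈ Matrix.unitaryGroup (Fin N) ℂ) (β : ℝ) {S : Finset (Site 4 L)}
    (hS : ∀ x ∈ S, x.negReflect - Pi.single 0 1 ∈ S) :
    ((gibbsProbability (Measure.pi fun _ : Edge 4 L => haarProbability G)
        (fun U => Real.exp (-(β * obcAction ρ 0 U)))).map (fun U => ∑ x ∈ S, cloverPseudoscalar ρ x U)).map Neg.neg =
      (gibbsProbability (Measure.pi fun _ : Edge 4 L => haarProbability G)
        (fun U => Real.exp (-(β * obcAction ρ 0 U)))).map (fun U => ∑ x ∈ S, cloverPseudoscalar ρ x U) :=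
  obcGibbs_map_neg_of_odd ρ hρ β
    (Finset.measurable_sum S fun x _ => measurable_cloverPseudoscalar ρ hρ x).aemeasurable
    (sum_cloverPseudoscalar_obcReflect ρ hρu hS)

/-- **Odd moments of the open-boundary charge vanish**: `⟨Q_S^{2k+1}⟩_OBC = 0` for every `k`. -/
theorem obcGibbs_cloverCharge_pow_odd_eq_zero [NeZero L] (hρ : Continuous ρ)
    (hρu : ∀ g, ρ g ∈ Matrix.unitaryGroup (Fin N) ℂ) (β : ℝ) {S : Finset (Site 4 L)}
    (hS : ∀ x ∈ S, x.negReflect - Pi.single 0 1 ∈ S) (k : ℕ) :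
    ∫ U, (∑ x ∈ S, cloverPseudoscalar ρ x U) ^ (2 * k + 1) ∂(gibbsProbability
      (Measure.pi fun _ : Edge 4 L => haarProbability G) (fun U => Real.exp (-(β * obcAction ρ 0 U)))) = 0 :=
  obcGibbs_integral_pow_odd_of_odd ρ hρ β (sum_cloverPseudoscalar_obcReflect ρ hρu hS) k

/-- **The `SU(N)` instance over all sites** (row 21's `OBC-HMC` arm: `N = 3`): `⟨Σ_x P_x⟩_OBC = 0` for the fundamental
representation, every real `β`, every `L ≥ 1`. -/
theorem obcGibbs_su_cloverCharge_integral_eq_zero [NeZero L] (n : ℕ) (β : ℝ) :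
    ∫ U, ∑ x : Site 4 L, cloverPseudoscalar (fundamentalRep (Fin n)) x U ∂(gibbsProbability
      (Measure.pi fun _ : Edge 4 L => haarProbability (Matrix.specialUnitaryGroup (Fin n) ℂ))
      (fun U => Real.exp (-(β * obcAction (fundamentalRep (Fin n)) 0 U)))) = 0 :=
  obcGibbs_cloverCharge_integral_eq_zero (fundamentalRep (Fin n)) (continuous_fundamentalRep (Fin n))
    fundamentalRep_mem_unitaryGroup β obcReflectSite_mem_univ

end Clover

end Summit.Ventures.LatticeQCDFlow.Exactness
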